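import Literature.Barriers.AtomisticToContinuum.AnticontinuumLocalizationCutoffs
import Mathlib.Analysis.InnerProductSpace.Projection.FiniteDimensional
import Mathlib.Analysis.InnerProductSpace.PiL2
import HarnessLib

/-!
# De Roeck–Huveneers 2015, §4.1 and Lemma 1: resonance subspaces and their projections

`Literature/Barriers/AtomisticToContinuum/` — the linear algebra behind §4 of W. De Roeck,
F. Huveneers, CPAM 68 (2015), arXiv:1305.5127, in the window `ℝ^m = EuclideanSpace ℝ (Fin m)`:

* modes as Euclidean vectors (`kvec k`, `⟪kvec k, ω⟫ = k·ω`, `1 ≤ ‖kvec k‖`, `‖kvec k‖ ≤ r m` for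
  bounded modes);
* the resonance subspace `modeSpan Q = span{k ∈ Q}` of a finite set of modes and the orthogonal
  projection `proj Q` onto it: `‖proj Q ω‖ = |ω - P(ω, ∩_{k∈Q} π(k))|₂` is the distance of `ω` to
  the exactly-resonant plane of `Q`;
* **Lemma 1** (one-step form, `norm_proj_insert_le`): for `k ∉ span Q`,
  `‖P_{Q∪{k}} ω‖ ≤ ‖P_Q ω‖ + (|k·ω| + ‖k‖ ‖P_Q ω‖)/‖k - P_Q k‖`, via the explicit formula
  `P_{V ⊕ u} ω = P_V ω + (⟪u,ω⟫/‖u‖²) u` (`starProjection_sup_singleton`); and its UNIFORM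
  version over all admissible `(Q, k)` with bounded integer modes (`exists_lemma1_const`).

All proved; no named facts.
-/

noncomputable section

open Function Set Finset Filter Metric WithLp
open scoped BigOperators Topology InnerProductSpace

namespace Literature.Barriers.AtomisticToContinuum.HeatConduction.RotorChain

open Literature.MathematicalPhysics.KineticTheory.HeatConduction

variable {m : ℕ}

/-! ### Modes as Euclidean vectors -/

/-- The window's frequency space `ℝ^m` with its Euclidean structure. [cite: DeRoeckHuveneers2015, §4.1] -/
abbrev Euc (m : ℕ) := EuclideanSpace ℝ (Fin m)

/-- A mode as a Euclidean vector. [cite: DeRoeckHuveneers2015, §4.1] -/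
def kvec (k : Fin m → ℤ) : Euc m := toLp 2 (modeVec k)

/-- Momenta as Euclidean vectors. [folklore] -/
def wvec (w : Fin m → ℝ) : Euc m := toLp 2 w

/-- Coordinates of `kvec`. [folklore] -/
@[simp] theorem kvec_apply (k : Fin m → ℤ) (y : Fin m) : kvec k y = (k y : ℝ) := rfl

/-- Coordinates of `wvec`. [folklore] -/
@[simp] theorem wvec_apply (w : Fin m → ℝ) (y : Fin m) : wvec w y = w y := rfl

/-- `⟪kvec k, wvec ω⟫ = k·ω`. [folklore] -/
theorem inner_kvec_wvec (k : Fin m → ℤ) (w : Fin m → ℝ) : ⟪kvec k, wvec w⟫_ℝ = modeFreq k w := by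
  rw [kvec, wvec, EuclideanSpace.inner_toLp_toLp]
  simp [dotProduct, modeFreq, modePhase, modeVec, mul_comm]

/-- A nonzero mode is a nonzero vector. [folklore] -/
theorem kvec_ne_zero {k : Fin m → ℤ} (hk : k ≠ 0) : kvec k ≠ 0 := by
  intro h; apply hk; funext y
  have := congrArg (fun v : Euc m => v y) h
  simpa using this

/-- `kvec` is injective. [folklore] -/
theorem kvec_injective : Function.Injective (kvec (m := m)) := by
  intro k k' h; funext y
  have := congrArg (fun v : Euc m => v y) h
  simpa using this

/-- **A nonzero integer mode has norm `≥ 1`.** [cite: DeRoeckHuveneers2015, §4.3 (proof of Lemma 1: "the norm of any nonzero vector in `K_r`")] -/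
theorem one_le_norm_kvec {k : Fin m → ℤ} (hk : k ≠ 0) : 1 ≤ ‖kvec k‖ := by
  obtain ⟨y, hy⟩ : ∃ y, k y ≠ 0 := Function.ne_iff.1 hk
  have h1 : (1 : ℝ) ≤ |(k y : ℝ)| := by
    have : (1 : ℤ) ≤ |k y| := Int.one_le_abs hy
    exact_mod_cast this
  have h2 : ‖(kvec k) y‖ ≤ ‖kvec k‖ := PiLp.norm_apply_le (kvec k) y
  rw [kvec_apply, Real.norm_eq_abs] at h2
  exact h1.trans h2

/-- Bounded modes are bounded vectors: `‖kvec k‖ ≤ r m` if `|k|_∞ ≤ r`. [cite: DeRoeckHuveneers2015, §4.1 ("`|k|₂ ≤ r²`")] -/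
theorem norm_kvec_le {k : Fin m → ℤ} {r : ℕ} (hk : ∀ y, |k y| ≤ r) : ‖kvec k‖ ≤ r * m := by
  rw [EuclideanSpace.norm_eq]
  have hsum : ∑ y, ‖(kvec k) y‖ ^ 2 ≤ ∑ _y : Fin m, (r : ℝ) ^ 2 := Finset.sum_le_sum fun y _ => by
    rw [kvec_apply, Real.norm_eq_abs]
    have : |(k y : ℝ)| ≤ r := by exact_mod_cast hk y
    exact pow_le_pow_left₀ (abs_nonneg _) this 2
  have hm : Real.sqrt (m : ℝ) ≤ m := by
    rcases Nat.eq_zero_or_pos m with h0 | h0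
    · subst h0; simp
    · have h1 : (1 : ℝ) ≤ m := by exact_mod_cast h0
      calc Real.sqrt m ≤ Real.sqrt ((m : ℝ) ^ 2) := Real.sqrt_le_sqrt (by nlinarith)
        _ = m := Real.sqrt_sq (by positivity)
  calc Real.sqrt (∑ y, ‖(kvec k) y‖ ^ 2) ≤ Real.sqrt (∑ _y : Fin m, (r : ℝ) ^ 2) := Real.sqrt_le_sqrt hsum
    _ = r * Real.sqrt m := by
        rw [Finset.sum_const, Finset.card_univ, Fintype.card_fin, nsmul_eq_mul, mul_comm, Real.sqrt_mul (sq_nonneg _),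
          Real.sqrt_sq (by positivity)]
    _ ≤ r * m := mul_le_mul_of_nonneg_left hm (by positivity)

/-! ### Resonance subspaces and projections -/

/-- The resonance subspace `span{k : k ∈ Q}` of a finite set of modes (its orthogonal complement is
`∩_{k ∈ Q} π(k)`). [cite: DeRoeckHuveneers2015, §4.1 (`π(k) = {ω : k·ω = 0}`) and §4.2 (definition of `B_δ(k_1,…,k_p)`)] -/
def modeSpan (Q : Finset (Fin m → ℤ)) : Submodule ℝ (Euc m) := Submodule.span ℝ (kvec '' (Q : Set (Fin m → ℤ)))

/-- Members span. [folklore] -/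
theorem kvec_mem_modeSpan {Q : Finset (Fin m → ℤ)} {k : Fin m → ℤ} (hk : k ∈ Q) : kvec k ∈ modeSpan Q :=
  Submodule.subset_span ⟨k, hk, rfl⟩

/-- Monotonicity. [folklore] -/
theorem modeSpan_mono {Q Q' : Finset (Fin m → ℤ)} (h : Q ⊆ Q') : modeSpan Q ≤ modeSpan Q' :=
  Submodule.span_mono (Set.image_mono (by exact_mod_cast h))

/-- The orthogonal projection onto the resonance subspace: `proj Q ω = ω - P(ω, ∩_{k∈Q} π(k))`, so
`‖proj Q ω‖` is the Euclidean distance of `ω` to the exactly-resonant plane. [cite: DeRoeckHuveneers2015, §4.2 (definition of `B_δ(k_1,…,k_p)`: "`|ω - P(ω, π(k_1) ∩ … ∩ π(k_p))|₂ ≤ L^p δ`")] -/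
def proj (Q : Finset (Fin m → ℤ)) : Euc m →L[ℝ] Euc m := (modeSpan Q).starProjection

/-- `proj Q ω ∈ span Q`. [folklore] -/
theorem proj_mem (Q : Finset (Fin m → ℤ)) (ω : Euc m) : proj Q ω ∈ modeSpan Q := (modeSpan Q).starProjection_apply_mem ω

/-- `ω - proj Q ω ⊥ span Q`. [folklore] -/
theorem sub_proj_mem_orthogonal (Q : Finset (Fin m → ℤ)) (ω : Euc m) : ω - proj Q ω ∈ (modeSpan Q)ᗮ :=
  (modeSpan Q).sub_starProjection_mem_orthogonal ω

/-- `‖proj Q ω‖ ≤ ‖ω‖`. [folklore] -/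
theorem norm_proj_le (Q : Finset (Fin m → ℤ)) (ω : Euc m) : ‖proj Q ω‖ ≤ ‖ω‖ := (modeSpan Q).norm_starProjection_apply_le ω

/-- For a member `k ∈ Q`, `k·ω = ⟪kvec k, proj Q ω⟫`: the frequency only sees the resonant part.
[cite: DeRoeckHuveneers2015, §4.3 (proof of Prop. 2, case 3: "`|k_j·ω''| = |k_j|₂ |ω'' - P(ω'', π(k_j))|₂ ≤ |k_j|₂ |ω'' - P(ω'', π(k_1) ∩ … ∩ π(k_{n₂}))|₂`")] -/
theorem inner_kvec_eq_inner_proj {Q : Finset (Fin m → ℤ)} {k : Fin m → ℤ} (hk : k ∈ Q) (ω : Euc m) :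
    ⟪kvec k, ω⟫_ℝ = ⟪kvec k, proj Q ω⟫_ℝ := by
  have h := (modeSpan Q).starProjection_inner_eq_zero ω (kvec k) (kvec_mem_modeSpan hk)
  rw [inner_sub_left, sub_eq_zero, real_inner_comm (kvec k) ω, real_inner_comm (kvec k)] at h
  exact h

/-- Hence `|k·ω| ≤ ‖k‖ ‖proj Q ω‖` for members. [cite: DeRoeckHuveneers2015, §4.3 (proof of Prop. 2, case 3)] -/
theorem abs_inner_kvec_le_of_mem {Q : Finset (Fin m → ℤ)} {k : Fin m → ℤ} (hk : k ∈ Q) (ω : Euc m) :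
    |⟪kvec k, ω⟫_ℝ| ≤ ‖kvec k‖ * ‖proj Q ω‖ := by
  rw [inner_kvec_eq_inner_proj hk]; exact abs_real_inner_le_norm _ _

/-- Nested projections: `proj Q (proj Q' ω) = proj Q ω` for `Q ⊆ Q'`. [folklore] -/
theorem proj_proj_of_subset {Q Q' : Finset (Fin m → ℤ)} (h : Q ⊆ Q') (ω : Euc m) : proj Q (proj Q' ω) = proj Q ω := by
  have := Submodule.starProjection_comp_starProjection_of_le (modeSpan_mono h)
  exact congrArg (fun f : Euc m →L[ℝ] Euc m => f ω) this

/-- Monotonicity of the resonant distance: `‖proj Q ω‖ ≤ ‖proj Q' ω‖` for `Q ⊆ Q'`. [folklore] -/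
theorem norm_proj_mono {Q Q' : Finset (Fin m → ℤ)} (h : Q ⊆ Q') (ω : Euc m) : ‖proj Q ω‖ ≤ ‖proj Q' ω‖ := by
  rw [← proj_proj_of_subset h ω]; exact norm_proj_le Q _

/-- **Pythagoras for nested resonance subspaces**: `‖P_{Q'} ω‖² = ‖P_Q ω‖² + ‖P_{Q'} ω - P_Q ω‖²` (`Q ⊆ Q'`).
[cite: DeRoeckHuveneers2015, §4.3 proof of Lemma 2 ("we start by writing the decompositions `|ω'|₂² = |ω' - P(ω', π(k'_1) ∩ … ∩ π(k'_{p'}))|₂² + |P(ω', π(k'_1) ∩ … ∩ π(k'_{p'}))|₂²`")] -/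
theorem norm_sq_proj_eq {Q Q' : Finset (Fin m → ℤ)} (h : Q ⊆ Q') (ω : Euc m) :
    ‖proj Q' ω‖ ^ 2 = ‖proj Q ω‖ ^ 2 + ‖proj Q' ω - proj Q ω‖ ^ 2 := by
  have hp := (modeSpan Q).norm_sq_eq_add_norm_sq_starProjection (proj Q' ω)
  have e1 : (modeSpan Q).starProjection (proj Q' ω) = proj Q ω := proj_proj_of_subset h ω
  have e2 : (modeSpan Q)ᗮ.starProjection (proj Q' ω) = proj Q' ω - proj Q ω := by
    have := (modeSpan Q).starProjection_add_starProjection_orthogonal (proj Q' ω)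
    rw [e1] at this
    exact (eq_sub_of_add_eq' this)
  rw [e1, e2] at hp
  exact hp

/-! ### Lemma 1: one-step extension of the resonance subspace -/

/-- **Projection onto `V ⊕ ℝu` for `u ⊥ V`, `u ≠ 0`: `P ω = P_V ω + (⟪u,ω⟫/‖u‖²) u`.** [folklore] -/
theorem starProjection_sup_singleton {V : Submodule ℝ (Euc m)} {u : Euc m} (hu : u ∈ Vᗮ) (hu0 : u ≠ 0) (ω : Euc m) :
    (V ⊔ (ℝ ∙ u)).starProjection ω = V.starProjection ω + (⟪u, ω⟫_ℝ / ‖u‖ ^ 2) • u := by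
  have hun : ‖u‖ ^ 2 ≠ 0 := pow_ne_zero 2 (norm_ne_zero_iff.2 hu0)
  refine Submodule.eq_starProjection_of_mem_orthogonal ?_ ?_
  · exact Submodule.mem_sup.2 ⟨V.starProjection ω, V.starProjection_apply_mem ω, _,
      Submodule.smul_mem _ _ (Submodule.mem_span_singleton_self u), rfl⟩
  · rw [← Submodule.inf_orthogonal, Submodule.mem_inf]
    constructor
    · have h1 : ω - V.starProjection ω ∈ Vᗮ := V.sub_starProjection_mem_orthogonal ω
      have h2 : (⟪u, ω⟫_ℝ / ‖u‖ ^ 2) • u ∈ Vᗮ := Submodule.smul_mem _ _ hu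
      have : ω - (V.starProjection ω + (⟪u, ω⟫_ℝ / ‖u‖ ^ 2) • u) = (ω - V.starProjection ω) - (⟪u, ω⟫_ℝ / ‖u‖ ^ 2) • u := by abel
      rw [this]; exact Submodule.sub_mem _ h1 h2
    · rw [Submodule.mem_orthogonal_singleton_iff_inner_right]
      have h3 : ⟪u, V.starProjection ω⟫_ℝ = 0 := by
        rw [real_inner_comm]; exact Submodule.inner_right_of_mem_orthogonal (V.starProjection_apply_mem ω) hu
      rw [inner_sub_right, inner_add_right, inner_smul_right, h3, zero_add, real_inner_self_eq_norm_sq]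
      field_simp; ring

/-- `V ⊔ ℝk = V ⊔ ℝu` when `k - u ∈ V`. [folklore] -/
theorem sup_span_singleton_eq {V : Submodule ℝ (Euc m)} {k u : Euc m} (h : k - u ∈ V) : V ⊔ (ℝ ∙ k) = V ⊔ (ℝ ∙ u) := by
  apply le_antisymm
  · refine sup_le le_sup_left ((Submodule.span_singleton_le_iff_mem _ _).2 ?_)
    have : k = (k - u) + u := by abel
    rw [this]; exact Submodule.add_mem _ (Submodule.mem_sup_left h) (Submodule.mem_sup_right (Submodule.mem_span_singleton_self u))
  · refine sup_le le_sup_left ((Submodule.span_singleton_le_iff_mem _ _).2 ?_)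
    have : u = k - (k - u) := by abel
    rw [this]; exact Submodule.sub_mem _ (Submodule.mem_sup_right (Submodule.mem_span_singleton_self k)) (Submodule.mem_sup_left h)

/-- Projections onto equal subspaces agree. [folklore] -/
theorem starProjection_congr {U V : Submodule ℝ (Euc m)} (h : U = V) (ω : Euc m) : U.starProjection ω = V.starProjection ω := by
  subst h; rfl

/-- `span(Q ∪ {k}) = span Q ⊔ ℝk`. [folklore] -/
theorem modeSpan_insert (k : Fin m → ℤ) (Q : Finset (Fin m → ℤ)) : modeSpan (insert k Q) = modeSpan Q ⊔ (ℝ ∙ kvec k) := by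
  unfold modeSpan
  rw [Finset.coe_insert, Set.image_insert_eq, Submodule.span_insert, sup_comm]

/-- **The explicit one-step projection**: with `u = k - P_Q k` (nonzero iff `k ∉ span Q`),
`P_{Q∪{k}} ω = P_Q ω + (⟪u, ω⟫/‖u‖²) u`. [cite: DeRoeckHuveneers2015, §4.3 proof of Lemma 1] -/
theorem proj_insert_eq {Q : Finset (Fin m → ℤ)} {k : Fin m → ℤ} (hk : kvec k ∉ modeSpan Q) (ω : Euc m) :
    proj (insert k Q) ω = proj Q ω +
      (⟪kvec k - proj Q (kvec k), ω⟫_ℝ / ‖kvec k - proj Q (kvec k)‖ ^ 2) • (kvec k - proj Q (kvec k)) := by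
  have hu : kvec k - proj Q (kvec k) ∈ (modeSpan Q)ᗮ := sub_proj_mem_orthogonal Q (kvec k)
  have hu0 : kvec k - proj Q (kvec k) ≠ 0 := by
    intro h
    rw [sub_eq_zero] at h
    exact hk (h ▸ proj_mem Q (kvec k))
  have e : modeSpan (insert k Q) = modeSpan Q ⊔ (ℝ ∙ (kvec k - proj Q (kvec k))) := by
    rw [modeSpan_insert, sup_span_singleton_eq (u := kvec k - proj Q (kvec k))
      (by rw [sub_sub_cancel]; exact proj_mem Q _)]
  show (modeSpan (insert k Q)).starProjection ω = _
  rw [starProjection_congr e ω]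
  exact starProjection_sup_singleton hu hu0 ω

/-- `⟪k - P_Q k, ω⟫ = ⟪k, ω⟫ - ⟪k, P_Q ω⟫`. [folklore] -/
theorem inner_sub_proj (Q : Finset (Fin m → ℤ)) (k ω : Euc m) : ⟪k - proj Q k, ω⟫_ℝ = ⟪k, ω⟫_ℝ - ⟪k, proj Q ω⟫_ℝ := by
  rw [inner_sub_left, proj, Submodule.inner_starProjection_left_eq_right]

/-- **Lemma 1 (one step)**: for `k ∉ span Q`,
`‖P_{Q∪{k}} ω‖ ≤ ‖P_Q ω‖ + (|⟪k,ω⟫| + ‖k‖ ‖P_Q ω‖)/‖k - P_Q k‖`. [cite: DeRoeckHuveneers2015, §4.3 Lemma 1] -/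
theorem norm_proj_insert_le {Q : Finset (Fin m → ℤ)} {k : Fin m → ℤ} (hk : kvec k ∉ modeSpan Q) (ω : Euc m) :
    ‖proj (insert k Q) ω‖ ≤ ‖proj Q ω‖ + (|⟪kvec k, ω⟫_ℝ| + ‖kvec k‖ * ‖proj Q ω‖) / ‖kvec k - proj Q (kvec k)‖ := by
  set u := kvec k - proj Q (kvec k) with hu
  have hu0 : u ≠ 0 := by
    intro h; rw [hu, sub_eq_zero] at h; exact hk (h ▸ proj_mem Q (kvec k))
  have hun : 0 < ‖u‖ := norm_pos_iff.2 hu0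
  rw [proj_insert_eq hk ω]
  calc ‖proj Q ω + (⟪u, ω⟫_ℝ / ‖u‖ ^ 2) • u‖ ≤ ‖proj Q ω‖ + ‖(⟪u, ω⟫_ℝ / ‖u‖ ^ 2) • u‖ := norm_add_le _ _
    _ = ‖proj Q ω‖ + |⟪u, ω⟫_ℝ| / ‖u‖ := by
        rw [norm_smul, Real.norm_eq_abs, abs_div, abs_of_pos (pow_pos hun 2)]
        field_simp
    _ ≤ ‖proj Q ω‖ + (|⟪kvec k, ω⟫_ℝ| + ‖kvec k‖ * ‖proj Q ω‖) / ‖u‖ := by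
        gcongr
        rw [hu, inner_sub_proj]
        exact (abs_sub _ _).trans (add_le_add le_rfl (abs_real_inner_le_norm _ _))

/-- **Lemma 1, uniform form**: one constant for all finite sets `Q` of `r`-bounded modes and all
`r`-bounded `k ∉ span Q` (finitely many configurations, each with a positive gap `‖k - P_Q k‖`).
[cite: DeRoeckHuveneers2015, §4.3 Lemma 1 ("Because they are only finitely many vectors `k ∈ K_r` … bounded from below by a strictly positive constant")] -/
theorem exists_lemma1_const (m r : ℕ) : ∃ C : ℝ, 0 ≤ C ∧ ∀ (Q : Finset (Fin m → ℤ)) (k : Fin m → ℤ),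
    (∀ k' ∈ Q, ∀ y, |k' y| ≤ r) → (∀ y, |k y| ≤ r) → kvec k ∉ modeSpan Q →
      ∀ ω : Euc m, ‖proj (insert k Q) ω‖ ≤ C * (|⟪kvec k, ω⟫_ℝ| + ‖proj Q ω‖) := by
  classical
  -- the finite set of configurations
  set Bset : Set (Fin m → ℤ) := {k | ∀ y, |k y| ≤ r} with hB
  have hBfin : Bset.Finite := by
    have h : Bset ⊆ Set.pi Set.univ (fun _ : Fin m => Set.Icc (-(r : ℤ)) r) := by
      intro k hk
      simp only [Set.mem_pi, Set.mem_univ, true_implies, Set.mem_Icc]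
      exact fun y => abs_le.1 (hk y)
    exact (Set.Finite.pi fun _ => Set.finite_Icc _ _).subset h
  set A : Set (Finset (Fin m → ℤ) × (Fin m → ℤ)) := {p | (↑p.1 : Set (Fin m → ℤ)) ⊆ Bset ∧ p.2 ∈ Bset} with hA
  have hAfin : A.Finite := by
    have : A ⊆ (↑(hBfin.toFinset.powerset) : Set (Finset (Fin m → ℤ))) ×ˢ Bset := by
      rintro ⟨Q, k⟩ ⟨hQ, hk⟩
      refine ⟨?_, hk⟩
      simp only [Finset.coe_powerset, Set.mem_preimage, Set.mem_powerset_iff, Set.Finite.coe_toFinset]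
      exact hQ
    exact ((hBfin.toFinset.powerset.finite_toSet).prod hBfin).subset this
  -- per-configuration constant
  let c : Finset (Fin m → ℤ) × (Fin m → ℤ) → ℝ := fun p =>
    max (1 / ‖kvec p.2 - proj p.1 (kvec p.2)‖) (1 + ‖kvec p.2‖ / ‖kvec p.2 - proj p.1 (kvec p.2)‖)
  have hc0 : ∀ p, 0 ≤ c p := fun p => le_max_of_le_left (by positivity)
  refine ⟨∑ p ∈ hAfin.toFinset, c p, Finset.sum_nonneg fun p _ => hc0 p, fun Q k hQ hk hkQ ω => ?_⟩
  have hmem : (Q, k) ∈ hAfin.toFinset := by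
    rw [Set.Finite.mem_toFinset]; exact ⟨fun k' hk' => hQ k' hk', hk⟩
  have hle : c (Q, k) ≤ ∑ p ∈ hAfin.toFinset, c p := Finset.single_le_sum (fun p _ => hc0 p) hmem
  set u := kvec k - proj Q (kvec k) with hu
  have hu0 : u ≠ 0 := by
    intro h; rw [hu, sub_eq_zero] at h; exact hkQ (h ▸ proj_mem Q (kvec k))
  have hun : 0 < ‖u‖ := norm_pos_iff.2 hu0
  have h1 := norm_proj_insert_le hkQ ω
  have hi0 : 0 ≤ |⟪kvec k, ω⟫_ℝ| := abs_nonneg _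
  have hp0 : 0 ≤ ‖proj Q ω‖ := norm_nonneg _
  calc ‖proj (insert k Q) ω‖ ≤ ‖proj Q ω‖ + (|⟪kvec k, ω⟫_ℝ| + ‖kvec k‖ * ‖proj Q ω‖) / ‖u‖ := h1
    _ = (1 / ‖u‖) * |⟪kvec k, ω⟫_ℝ| + (1 + ‖kvec k‖ / ‖u‖) * ‖proj Q ω‖ := by field_simp; ring
    _ ≤ c (Q, k) * |⟪kvec k, ω⟫_ℝ| + c (Q, k) * ‖proj Q ω‖ := by
        gcongr
        · exact le_max_left _ _
        · exact le_max_right _ _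
    _ = c (Q, k) * (|⟪kvec k, ω⟫_ℝ| + ‖proj Q ω‖) := by ring
    _ ≤ (∑ p ∈ hAfin.toFinset, c p) * (|⟪kvec k, ω⟫_ℝ| + ‖proj Q ω‖) := mul_le_mul_of_nonneg_right hle (by positivity)

end Literature.Barriers.AtomisticToContinuum.HeatConduction.RotorChain

end
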